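import Literature.AnabelianGeometry.SemiGraphs.CoveringGraphEquiv
import Literature.AnabelianGeometry.SemiGraphs.CoveringGraphHypothesesBasic
import Literature.AnabelianGeometry.SemiGraphs.UniformSplittingStrictlyCoherentProofs
import HarnessLib

/-!
# Galois-countability is hereditary along tempered coverings of FINITE degree over ANY
# Galois-countable base (route T, T7d — the «pre H′» mechanism)

Mochizuki, *Semi-graphs of anabelioids*, Publ. RIMS **42** (2006), §3 Def. 3.5 (i)–(ii) p. 37 (the
covering semi-graph of anabelioids `G_S → G` of `S ∈ B^cov(G)`, `CovObj.coveringGraph`; finite objects),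
proof of Prop. 3.6 (v) p. 40 ("we may assume … that the covering `H' → G'` is finite étale")
[cite: MochizukiSemiAnbd2006, Prop 3.6(v) p.40]; Galois-countability [IUTchI] Rmk. 2.5.3 (i) (T2) p. 52
[cite: Mochizuki2012, IUTchI Rem. 2.5.3(i)(T2) p.52].

PROOF-ONLY (abc-iut cell, layer L3, route T · T7d, seat abc-iut-L3-t5; no definition, no statement of the
paper retyped).  For a covering `S` of FINITE degree (all fibres finite; no temperedness, connectedness
or coherence needed) and a finite object `H'` of `B^cov(G_S)`, the composite «pre `H'`» — abc-iut-L3-d6's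
`CovObj.pre H' : Over S` (`CoveringGraphEquiv`, the essential preimage under
`B^cov(G)_S ≌ B^cov(G_S)`) — is a FINITE object of `B^cov(G)` (`CovObj.isFinite_pre`, from the
finiteness of the base-point fibres, `BTemp.finite_left_of_finite_ptFibre`); a member of the
(T2)-family of `G` splitting it constituentwise pulls back along `G_S → G` to a finite object of
`B^cov(G_S)` splitting `H'` (transport through `CovObj.preIsoV` / `preIsoE`).  Hence:

* `CovObj.isGaloisCountable_coveringGraph_of_isFinite (hGC : G.IsGaloisCountable) (hS : S.IsFinite) :
  G_S.IsGaloisCountable` — **(T2) is hereditary in finite degree over every Galois-countable base.**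

With the companion files this completes the picture of the heredity of (T2) along coverings `S`:
finite degree — any Galois-countable base (here); infinite degree — coherent bases
(`CoveringGraphCoherent`); infinite degree over an incoherent base — fails
(`CoveringGraphGaloisCountableNegative`).  Nothing here bears on [IUTchIII] Cor. 3.12.
-/

noncomputable section

open CategoryTheory Topology

namespace Literature.AnabelianGeometry.SemiGraphs

open Literature.AlgebraicGeometry.Frobenioids.QuasiTemperoid.BTempConnected (hom_ρ ρ_one_apply
  ρ_mul_apply ρ_inv_apply)
open GaloisObjects (iso_inv_hom_apply iso_hom_inv_apply)

universe u

namespace BTemp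

variable {G : Type u} [Group G] [TopologicalSpace G]

/-! ### Finiteness of an object over a finite base from its base-point fibres -/

/-- Translating a point fibre into the base-point fibre of its orbit (by the chosen `γ_x⁻¹`) is
injective. [cite: MochizukiSemiAnbd2006, Def 3.5(i) p.37] -/
theorem finite_ptFibre_of_finite_base_ptFibre {X : BTemp G} (U : Over X) (x : X.obj.V)
    (h : Finite (PtFibre U (Quot.out (cl X x)))) : Finite (PtFibre U x) := by
  refine Finite.of_injective (fun t : PtFibre U x =>
    (⟨U.left.obj.ρ (sec X x)⁻¹ t.1, by rw [hom_ρ, t.2, ρ_sec_inv]⟩ : PtFibre U (Quot.out (cl X x)))) ?_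
  intro t t' htt'
  apply Subtype.ext
  have h1 := congrArg (fun s : PtFibre U (Quot.out (cl X x)) => U.left.obj.ρ (sec X x) s.1) htt'
  simpa only [← ρ_mul_apply, mul_inv_cancel, ρ_one_apply] using h1

/-- **An object over a finite `X` with finite base-point fibres is finite** (its points are the
disjoint union of its point fibres). [cite: MochizukiSemiAnbd2006, Def 3.5(i) p.37] -/
theorem finite_left_of_finite_ptFibre {X : BTemp G} [Finite X.obj.V] (U : Over X)
    (h : ∀ ω : Orbits X, Finite (PtFibre U (Quot.out ω))) : Finite U.left.obj.V := by
  haveI : ∀ x : X.obj.V, Finite (PtFibre U x) := fun x =>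
    finite_ptFibre_of_finite_base_ptFibre U x (h (cl X x))
  exact Finite.of_surjective (fun p : Σ x : X.obj.V, PtFibre U x => p.2.1)
    fun t => ⟨⟨U.hom.hom.hom t, ⟨t, rfl⟩⟩, rfl⟩

end BTemp

namespace ProfiniteSemiGraph

namespace CovObj

variable {𝒢 : ProfiniteSemiGraph.{u}} (S : CovObj 𝒢)

/-! ### «pre `H'`» is finite for `S` and `H'` finite -/

/-- **The composite of finite coverings is finite**: for `S` of finite degree and `H'` a finite object of
`B^cov(G_S)`, the preimage `pre H' → S` (abc-iut-L3-d6, `CoveringGraphEquiv`) is a finite object of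
`B^cov(G)` — its base-point fibres are the fibres of `H'` (`preIsoV` / `preIsoE`).
[cite: MochizukiSemiAnbd2006, Prop 3.6(v) p.40] -/
theorem isFinite_pre (hS : S.IsFinite) (T' : CovObj S.coveringGraph) (hT' : T'.IsFinite) :
    (S.pre T').left.IsFinite := by
  refine ⟨fun v => ?_, fun e => ?_⟩
  · haveI : Finite (S.SV v).obj.V := hS.finite_V v
    refine BTemp.finite_left_of_finite_ptFibre (S.preV T' v) fun ω => ?_
    haveI : Finite (T'.SV ⟨v, ω⟩).obj.V := hT'.finite_V ⟨v, ω⟩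
    exact Finite.of_equiv _ (equivOfIso (S.preIsoV T' ⟨v, ω⟩)).symm
  · haveI : Finite (S.SE e).obj.V := hS.finite_E e
    refine BTemp.finite_left_of_finite_ptFibre (S.preE T' e) fun ω => ?_
    haveI : Finite (T'.SE ⟨e, ω⟩).obj.V := hT'.finite_E ⟨e, ω⟩
    exact Finite.of_equiv _ (equivOfIso (S.preIsoE T' ⟨e, ω⟩)).symm

/-! ### (T2) in finite degree -/

/-- Transfer of pointwise triviality through the comparison `toCovering (pre H') ≅ H'` at a vertex: if
`k ∈ Π_{(v,ω)} = Stab_{Π_v}(x_ω)` fixes every point of `(pre H')_v`, it fixes every point of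
`H'_{(v,ω)}`. [cite: MochizukiSemiAnbd2006, Prop 3.6(v) p.40] -/
theorem ρ_eq_of_fixes_pre_V (T' : CovObj S.coveringGraph) (v' : S.coveringGraph.graph.Vertex)
    (k : S.coveringGraph.Gv v')
    (hk : ∀ s : ((S.pre T').left.SV v'.1).obj.V, ((S.pre T').left.SV v'.1).obj.ρ (k : 𝒢.Gv v'.1) s = s)
    (y : (T'.SV v').obj.V) : (T'.SV v').obj.ρ k y = y := by
  let e := S.preIsoV T' v'
  have h1 : ∀ t : ((S.toCovering.obj (S.pre T')).SV v').obj.V,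
      ((S.toCovering.obj (S.pre T')).SV v').obj.ρ k t = t := fun t => Subtype.ext (hk t.1)
  calc (T'.SV v').obj.ρ k y = (T'.SV v').obj.ρ k (e.hom.hom.hom (e.inv.hom.hom y)) := by
        rw [iso_hom_inv_apply]
    _ = e.hom.hom.hom (((S.toCovering.obj (S.pre T')).SV v').obj.ρ k (e.inv.hom.hom y)) :=
        (hom_ρ e.hom k _).symm
    _ = y := by rw [h1, iso_hom_inv_apply]

/-- The same at an edge. [cite: MochizukiSemiAnbd2006, Prop 3.6(v) p.40] -/
theorem ρ_eq_of_fixes_pre_E (T' : CovObj S.coveringGraph) (e' : S.coveringGraph.graph.Edge)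
    (k : S.coveringGraph.Ge e')
    (hk : ∀ s : ((S.pre T').left.SE e'.1).obj.V, ((S.pre T').left.SE e'.1).obj.ρ (k : 𝒢.Ge e'.1) s = s)
    (y : (T'.SE e').obj.V) : (T'.SE e').obj.ρ k y = y := by
  let e := S.preIsoE T' e'
  have h1 : ∀ t : ((S.toCovering.obj (S.pre T')).SE e').obj.V,
      ((S.toCovering.obj (S.pre T')).SE e').obj.ρ k t = t := fun t => Subtype.ext (hk t.1)
  calc (T'.SE e').obj.ρ k y = (T'.SE e').obj.ρ k (e.hom.hom.hom (e.inv.hom.hom y)) := by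
        rw [iso_hom_inv_apply]
    _ = e.hom.hom.hom (((S.toCovering.obj (S.pre T')).SE e').obj.ρ k (e.inv.hom.hom y)) :=
        (hom_ρ e.hom k _).symm
    _ = y := by rw [h1, iso_hom_inv_apply]

/-- **(T2) is hereditary along coverings of finite degree over ANY Galois-countable base**
([IUTchI] Rmk. 2.5.3 (i) (T2)): for `G` Galois-countable and `S ∈ B^cov(G)` finite (all fibres finite —
no temperedness, connectedness or coherence assumed), `G_S` is Galois-countable; the (T2)-family of `G_S`
is the pull-back `i ↦ (G_S → G)^*(F_i)` of that of `G`, and a finite `H'` over `G_S` is split by the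
pull-back of any `F_i` splitting the finite composite «pre `H'`». [cite: Mochizuki2012, IUTchI Rem. 2.5.3(i)(T2) p.52] -/
theorem isGaloisCountable_coveringGraph_of_isFinite (hGC : 𝒢.IsGaloisCountable) (hS : S.IsFinite) :
    S.coveringGraph.IsGaloisCountable := by
  obtain ⟨hcnt, F, hF, hsplit⟩ := hGC
  refine ⟨S.isCountable_coveringGraph hcnt, fun i => S.coveringHom.covPullback.obj (F i),
    fun i => ⟨S.coveringHom.isFinite_covPullback (hF i).1,
      S.coveringHom.hasNonemptyFibres_covPullback (hF i).2⟩, fun H hH => ?_⟩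
  obtain ⟨i, hiV, hiE⟩ := hsplit (S.pre H).left (S.isFinite_pre hS H hH)
  refine ⟨i, fun v' x k hk y => ?_, fun e' x k hk y => ?_⟩
  · exact S.ρ_eq_of_fixes_pre_V H v' k (hiV v'.1 x (k : 𝒢.Gv v'.1) hk) y
  · exact S.ρ_eq_of_fixes_pre_E H e' k (hiE e'.1 x (k : 𝒢.Ge e'.1) hk) y

end CovObj

end ProfiniteSemiGraph

end Literature.AnabelianGeometry.SemiGraphs
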